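import Literature.MathematicalPhysics.QuantumFieldTheory.Balaban1983to89.Beta.BalabanStepJets

/-!
# `BalabanUV.Beta.D1BFx.LamCoeffAffineNull` — road «BF-x» for binder row D1, slot (K), census group **G_Λ**, identity (I) «AFFINE-MOMENT NULL OF THE
# MULTIPLIER RESPONSE»: for every affine weight `f(u) = Σ_β m_β u_β + c`, every summable left kernel `A` (`Decays A C δ`, `δ > 0`), blocking `N`, coarse bond
# `(μ, y)` and fine direction `κ′`:   `Σ_{u ∈ ℤ^{d+1}} f(u) · lamCoeffOf A N μ y κ′ u = 0`
# — the `Λ′`-profile of Bałaban's multiplier response has ZERO MONOPOLE AND ZERO DIPOLE, because the multiplier sees the fine source only through the columns of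
# the flat Wilson Hessian `E″(1) = d*d`, whose column space is annihilated by affine 1-forms (`AffineAveraging.curvAdj_curv_affine`)

HONEST DEPENDENCY (cell records, verbatim): «continuum YM on T⁴ ⇐ BetaPertH ∧ nine spine estimates (0/9 proved); BetaPertH ⇐ (D1) ∧ (D4) ∧
CAP+tail; G-an2-4 gates asym, D1 and NE2/3/4.»  HONEST FRAMING (cell contract, verbatim): «discharging `BetaPertH` makes Bałaban's UV stability
UNCONDITIONAL — a real constructive-QFT result; it is NOT the continuum limit and NOT the Clay problem.»  THIS MODULE DISCHARGES NOTHING of (K),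
of D1 or of the wall: [folklore] finite-difference algebra and dominated summation over the tree objects `AffineAveraging.curv ∕ curvAdj ∕ affine`,
`BalabanStepJets.bondDelta ∕ elCol ∕ box1 ∕ lamCoeffOf`, `ExpKernelCalculus.Decays` BY NAME.  No definition, no `def … : Prop`, nothing cited, no wall
binder instantiated, 0 sorry.  NOT D1, NOT BetaPertH, NOT continuum, NOT Clay.

ABSOLUTE RULE (cell charter, verbatim): «No internally-minted statement may enter as a cited fact. Every hypothesis is either kernel-proved in this
package or a verbatim quotation of a PUBLISHED theorem with page reference. The manuscript(s) under audit are NOT citable for their own disputed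
steps — they are the thing under adjudication; programme-internal (2001/route/tribunal) claims are never citable.»

WHERE THIS SITS (`HOME/b2b-balaban-beta-d1-p2/K-CLOSURE-PLAN-R1L.md` §4 (Λ), `CENSUS-K6a-v1.md` §v4, an3-g51's LETTER «Λ-NULL» v1.0.1 §1): the census
group G_Λ (every one-loop word with a `Λ′` leg) is `(0;0)` in the block-averaged second-moment channels by (I) this identity + (II) a factorisation +
(III) one zero-momentum Ward letter.  (I) is binder-free; this file is its kernel form.  It is an input of the END-reshape row `hLam`, nothing more.

CONTENT.
* §1 [folklore] `box1` membership helpers; **`curvAdj_curv_sum_mul`** (the Euler–Lagrange operator `curvAdj ∘ curv` is linear over weighted finite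
  families); **`curvAdj_curv_congr_box1`** (LOCALITY: `(curvAdj (curv B)) α x` reads `B` only at sites `z` with `z − x ∈ box1`).
* §2 [folklore] **`sum_box1_affine_mul_elCol`**: `∑ v ∈ box1 D, f(x − v) · elCol κ′ (x − v) α x = 0` for affine `f` — the finite core (truncate the
  `κ′`-component affine 1-form to the unit box around the output row, §1, `curvAdj_curv_affine`).
* §3 [folklore] **`summable_affine_mul_lamCoeffOf`**, **`tsum_affine_mul_lamCoeffOf`**: the displayed identity (Fubini over `box1 × Fin (d+1)` by
  `Decays A C δ` and `B12Sec2to5.majorant_summable`, lattice shift `u = x − v`, §2 pointwise in `x`).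
Unit `b2b-balaban-beta-d1-p2` (road owner, gen 9).
-/

noncomputable section

open Finset Filter Topology
open scoped BigOperators
open Literature.MathematicalPhysics.QuantumFieldTheory.Balaban1983to89
open Literature.MathematicalPhysics.QuantumFieldTheory.Balaban1983to89.Beta
open B12Sec2to5 (l1 l1_nonneg)
open ExpKernelCalculus (Decays MKer)
open OneStepResolventKernel (Fib)
open AffineAveraging (Site Form1 Form2 unitVec unitVec_apply curv curvAdj affine curvAdj_curv_affine)
open BalabanStepJets (bondDelta elCol box1 mem_box1 lamCoeffOf l1_le_of_mem_box1 abs_elCol_le)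

namespace Summit.QuantumFields.BalabanUV.Beta.D1BFx.LamCoeffAffineNull

/-! ## §1 Box helpers, linearity and locality of `curvAdj ∘ curv` -/

section Box

variable {D : ℕ}

/-- [folklore] `0 ∈ box1`. -/
theorem zero_mem_box1 : (0 : Fin D → ℤ) ∈ box1 D := by
  rw [mem_box1]; intro i; simp

/-- [folklore] `e_μ ∈ box1`. -/
theorem unitVec_mem_box1 (μ : Fin D) : (unitVec μ : Fin D → ℤ) ∈ box1 D := by
  rw [mem_box1]; intro i; rw [unitVec_apply]; split_ifs <;> simp

/-- [folklore] `−e_μ ∈ box1`. -/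
theorem neg_unitVec_mem_box1 (μ : Fin D) : (-unitVec μ : Fin D → ℤ) ∈ box1 D := by
  rw [mem_box1]; intro i; rw [Pi.neg_apply, unitVec_apply]; split_ifs <;> simp

/-- [folklore] `e_μ − e_l ∈ box1`. -/
theorem unitVec_sub_unitVec_mem_box1 (μ l : Fin D) : (unitVec μ - unitVec l : Fin D → ℤ) ∈ box1 D := by
  rw [mem_box1]; intro i; rw [Pi.sub_apply, unitVec_apply, unitVec_apply]; split_ifs <;> simp

/-- [folklore] `box1` is symmetric under `v ↦ −v`. -/
theorem neg_mem_box1 {v : Fin D → ℤ} (hv : v ∈ box1 D) : -v ∈ box1 D := by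
  rw [mem_box1] at hv ⊢
  intro i
  rcases hv i with h | h | h <;> simp [h]

/-- [folklore] **LINEARITY OF `curv`** over a weighted finite family of 1-forms. -/
theorem curv_sum_mul {ι : Type*} (s : Finset ι) (g : ι → ℝ) (B : ι → Form1 D ℝ) (κ l : Fin D) (x : Site D) :
    curv (fun l' z => ∑ i ∈ s, g i * B i l' z) κ l x = ∑ i ∈ s, g i * curv (B i) κ l x := by
  simp only [curv, mul_add, mul_sub, Finset.sum_add_distrib, Finset.sum_sub_distrib]

/-- [folklore] Additivity of `curvAdj` (pointwise). -/
theorem curvAdj_add_apply (F G : Form2 D ℝ) (μ : Fin D) (y : Site D) :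
    curvAdj (fun κ l z => F κ l z + G κ l z) μ y = curvAdj F μ y + curvAdj G μ y := by
  simp only [curvAdj, Finset.sum_add_distrib, Finset.sum_sub_distrib]
  ring

/-- [folklore] Homogeneity of `curvAdj` (pointwise). -/
theorem curvAdj_const_mul_apply (g : ℝ) (F : Form2 D ℝ) (μ : Fin D) (y : Site D) :
    curvAdj (fun κ l z => g * F κ l z) μ y = g * curvAdj F μ y := by
  simp only [curvAdj, mul_add, mul_sub, Finset.mul_sum]

/-- [folklore] **LINEARITY OF `curvAdj`** over a weighted finite family of 2-forms. -/
theorem curvAdj_sum_mul {ι : Type*} (s : Finset ι) (g : ι → ℝ) (F : ι → Form2 D ℝ) (μ : Fin D) (y : Site D) :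
    curvAdj (fun κ l z => ∑ i ∈ s, g i * F i κ l z) μ y = ∑ i ∈ s, g i * curvAdj (F i) μ y := by
  classical
  induction s using Finset.induction_on with
  | empty => simp [curvAdj]
  | insert a s ha ih =>
    simp only [Finset.sum_insert ha]
    rw [← ih, ← curvAdj_const_mul_apply, ← curvAdj_add_apply]

/-- [folklore] **LINEARITY OF THE EULER–LAGRANGE OPERATOR `curvAdj ∘ curv`** over a weighted finite family of 1-forms. -/
theorem curvAdj_curv_sum_mul {ι : Type*} (s : Finset ι) (g : ι → ℝ) (B : ι → Form1 D ℝ) (μ : Fin D) (y : Site D) :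
    curvAdj (curv (fun l z => ∑ i ∈ s, g i * B i l z)) μ y = ∑ i ∈ s, g i * curvAdj (curv (B i)) μ y := by
  have h : curv (fun l z => ∑ i ∈ s, g i * B i l z) = fun κ l x => ∑ i ∈ s, g i * curv (B i) κ l x := by
    funext κ l x; exact curv_sum_mul s g B κ l x
  rw [h, curvAdj_sum_mul]

/-- [folklore] **LOCALITY OF `curvAdj ∘ curv`**: the value at the row `(α, x)` depends on the 1-form only at sites `z` with `z − x ∈ box1` (the stencil of
`d*d` reads `x`, `x ± e_l`, `x + e_μ − e_l`). -/
theorem curvAdj_curv_congr_box1 {B B' : Form1 D ℝ} {x : Site D} (h : ∀ (l : Fin D) (z : Site D), z - x ∈ box1 D → B l z = B' l z) (α : Fin D) :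
    curvAdj (curv B) α x = curvAdj (curv B') α x := by
  have h0 : ∀ l, B l x = B' l x := fun l => h l x (by rw [sub_self]; exact zero_mem_box1)
  have h1 : ∀ l μ, B l (x + unitVec μ) = B' l (x + unitVec μ) := fun l μ => h l _ (by rw [add_sub_cancel_left]; exact unitVec_mem_box1 μ)
  have h2 : ∀ l μ, B l (x - unitVec μ) = B' l (x - unitVec μ) := fun l μ =>
    h l _ (by rw [show x - unitVec μ - x = -unitVec μ by abel]; exact neg_unitVec_mem_box1 μ)
  have h3 : ∀ l μ ν, B l (x - unitVec μ + unitVec ν) = B' l (x - unitVec μ + unitVec ν) := fun l μ ν =>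
    h l _ (by rw [show x - unitVec μ + unitVec ν - x = unitVec ν - unitVec μ by abel]; exact unitVec_sub_unitVec_mem_box1 ν μ)
  simp only [curvAdj, curv, h0, h1, h2, h3]

end Box

/-! ## §2 The finite core: affine weights against the columns of `d*d` at a fixed row -/

section Core

variable {D : ℕ}

/-- [folklore] The `κ′`-component affine 1-form, evaluated: `affine m′ c′ l z = [l = κ′]·(Σ_β m_β z_β + c)` for `m′ l β := [l = κ′]·m_β`, `c′ l := [l = κ′]·c`. -/
theorem affine_single_apply (m : Fin D → ℝ) (c : ℝ) (κ' l : Fin D) (z : Site D) :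
    affine (fun l' β => if l' = κ' then m β else 0) (fun l' => if l' = κ' then c else 0) l z =
      if l = κ' then (∑ β, m β * (z β : ℝ)) + c else 0 := by
  simp only [affine]
  split_ifs with h
  · rfl
  · simp

/-- [folklore] The box truncation of the `κ′`-component affine form around the row site `x`, evaluated inside the box: for `z − x ∈ box1`,
`Σ_{v ∈ box1} f(x − v)·bondDelta κ′ (x − v) l z = [l = κ′]·f(z)`. -/
theorem sum_box1_mul_bondDelta_apply (f : Site D → ℝ) (κ' l : Fin D) (x z : Site D) (hz : z - x ∈ box1 D) :
    (∑ v ∈ box1 D, f (x - v) * bondDelta κ' (x - v) l z) = if l = κ' then f z else 0 := by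
  by_cases hl : l = κ'
  · subst hl
    simp only [bondDelta, true_and, if_true, mul_ite, mul_one, mul_zero]
    have hx : x - z ∈ box1 D := by
      have := neg_mem_box1 hz
      rwa [neg_sub] at this
    rw [Finset.sum_ite, Finset.sum_const_zero, add_zero]
    have hfilter : (box1 D).filter (fun v => z = x - v) = {x - z} := by
      ext v
      simp only [Finset.mem_filter, Finset.mem_singleton]
      constructor
      · rintro ⟨-, e⟩; rw [e]; abel
      · intro e; subst e; exact ⟨hx, by abel⟩
    rw [hfilter, Finset.sum_singleton, sub_sub_cancel]
  · simp [bondDelta, hl]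

/-- [folklore] **AFFINE-MOMENT NULL OF THE COLUMNS OF `d*d`, FINITE CORE**: at every row `(α, x)`, the columns `(κ′, u)`, `u = x − v`, `v ∈ box1`
(the only columns meeting the row), weighted by an AFFINE function of the column site, sum to zero:
`∑ v ∈ box1 D, ((Σ_β m_β (x − v)_β) + c) · elCol κ′ (x − v) α x = 0`.  Proof: the weighted sum of bond deltas is the box truncation of the `κ′`-component
affine 1-form; `curvAdj ∘ curv` is linear and local (§1), and kills affine 1-forms (`AffineAveraging.curvAdj_curv_affine`). -/
theorem sum_box1_affine_mul_elCol (m : Fin D → ℝ) (c : ℝ) (κ' α : Fin D) (x : Site D) :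
    (∑ v ∈ box1 D, ((∑ β, m β * ((x - v) β : ℝ)) + c) * elCol κ' (x - v) α x) = 0 := by
  set f : Site D → ℝ := fun u => (∑ β, m β * (u β : ℝ)) + c with hf
  have step1 : (∑ v ∈ box1 D, f (x - v) * elCol κ' (x - v) α x) =
      curvAdj (curv (fun l z => ∑ v ∈ box1 D, f (x - v) * bondDelta κ' (x - v) l z)) α x := by
    rw [curvAdj_curv_sum_mul]
    rfl
  have step2 : curvAdj (curv (fun l z => ∑ v ∈ box1 D, f (x - v) * bondDelta κ' (x - v) l z)) α x =
      curvAdj (curv (affine (fun l' β => if l' = κ' then m β else 0) (fun l' => if l' = κ' then c else 0))) α x := by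
    refine curvAdj_curv_congr_box1 (fun l z hz => ?_) α
    rw [sum_box1_mul_bondDelta_apply f κ' l x z hz, affine_single_apply]
  have step3 : curvAdj (curv (affine (R := ℝ) (fun l' β => if l' = κ' then m β else 0) (fun l' => if l' = κ' then c else 0))) α x = 0 := by
    rw [curvAdj_curv_affine]; rfl
  show (∑ v ∈ box1 D, f (x - v) * elCol κ' (x - v) α x) = 0
  rw [step1, step2, step3]

end Core

/-! ## §3 The affine-moment null of `lamCoeffOf` (absolutely convergent lattice sum) -/

section LamCoeff

variable {d : ℕ}

/-- [folklore] Coordinatewise bound: `|(x − v)_β| ≤ |x₀ − x|₁ + |(x₀ − v)_β|`. -/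
theorem abs_sub_coord_le (x v x₀ : Fin (d + 1) → ℤ) (β : Fin (d + 1)) :
    |(((x - v) β : ℤ) : ℝ)| ≤ l1 (x₀ - x) + |(((x₀ - v) β : ℤ) : ℝ)| := by
  have h1 : (((x - v) β : ℤ) : ℝ) = -(((x₀ - x) β : ℤ) : ℝ) + (((x₀ - v) β : ℤ) : ℝ) := by
    simp only [Pi.sub_apply, Int.cast_sub]; ring
  rw [h1]
  have h2 := B12Sec2to5.abs_coord_le_l1 (x₀ - x) β
  calc |-(((x₀ - x) β : ℤ) : ℝ) + (((x₀ - v) β : ℤ) : ℝ)| ≤ |-(((x₀ - x) β : ℤ) : ℝ)| + |(((x₀ - v) β : ℤ) : ℝ)| := abs_add_le _ _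
    _ ≤ l1 (x₀ - x) + |(((x₀ - v) β : ℤ) : ℝ)| := by
        rw [abs_neg]
        linarith

/-- [folklore] **AFFINE WEIGHTS GROW AT MOST LINEARLY** in `|x₀ − x|₁`: `|Σ_β m_β (x − v)_β + c| ≤ (Σ_β |m_β|)·|x₀ − x|₁ + (Σ_β |m_β|·|(x₀ − v)_β| + |c|)`. -/
theorem abs_affine_weight_le (m : Fin (d + 1) → ℝ) (c : ℝ) (x v x₀ : Fin (d + 1) → ℤ) :
    |(∑ β, m β * (((x - v) β : ℤ) : ℝ)) + c| ≤
      (∑ β, |m β|) * l1 (x₀ - x) + ((∑ β, |m β| * |(((x₀ - v) β : ℤ) : ℝ)|) + |c|) := by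
  have hs1 : |∑ β, m β * (((x - v) β : ℤ) : ℝ)| ≤ ∑ β, |m β * (((x - v) β : ℤ) : ℝ)| := Finset.abs_sum_le_sum_abs _ _
  have hs2 : (∑ β, |m β * (((x - v) β : ℤ) : ℝ)|) ≤ ∑ β, |m β| * (l1 (x₀ - x) + |(((x₀ - v) β : ℤ) : ℝ)|) := by
    refine Finset.sum_le_sum fun β _ => ?_
    rw [abs_mul]
    exact mul_le_mul_of_nonneg_left (abs_sub_coord_le x v x₀ β) (abs_nonneg _)
  have hs3 : (∑ β, |m β| * (l1 (x₀ - x) + |(((x₀ - v) β : ℤ) : ℝ)|)) =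
      (∑ β, |m β|) * l1 (x₀ - x) + ∑ β, |m β| * |(((x₀ - v) β : ℤ) : ℝ)| := by
    rw [Finset.sum_mul, ← Finset.sum_add_distrib]
    refine Finset.sum_congr rfl fun β _ => ?_
    ring
  calc |(∑ β, m β * (((x - v) β : ℤ) : ℝ)) + c| ≤ |∑ β, m β * (((x - v) β : ℤ) : ℝ)| + |c| := abs_add_le _ _
    _ ≤ (∑ β, |m β|) * l1 (x₀ - x) + ((∑ β, |m β| * |(((x₀ - v) β : ℤ) : ℝ)|) + |c|) := by linarith

/-- [folklore] The shifted summand of the affine-weighted coefficient, one `(v, α)` at a time: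
`H v α x := f(x − v) · A x₀ x (inr μ) (inl α) · elCol κ′ (x − v) α x` is ABSOLUTELY SUMMABLE over `x ∈ ℤ^{d+1}` when `Decays A C δ`, `δ > 0`
(domination by `(K₀ + K₁|x₀ − x|₁²)·e^{−δ|x₀ − x|₁}`, `B12Sec2to5.majorant_summable`). -/
theorem summable_shifted_term {A : MKer (d + 1) (Fib d)} {C δ : ℝ} (hA : Decays A C δ) (hC : 0 ≤ C) (hδ : 0 < δ)
    (m : Fin (d + 1) → ℝ) (c : ℝ) (x₀ : Fin (d + 1) → ℤ) (μ κ' α : Fin (d + 1)) (v : Fin (d + 1) → ℤ) :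
    Summable fun x : Fin (d + 1) → ℤ =>
      ((∑ β, m β * (((x - v) β : ℤ) : ℝ)) + c) * (A x₀ x (Sum.inr μ) (Sum.inl α) * elCol κ' (x - v) α x) := by
  set M : ℝ := ∑ β, |m β| with hM
  set K : ℝ := (∑ β, |m β| * |(((x₀ - v) β : ℤ) : ℝ)|) + |c| with hK
  have hM0 : 0 ≤ M := Finset.sum_nonneg fun β _ => abs_nonneg _
  have hK0 : 0 ≤ K := add_nonneg (Finset.sum_nonneg fun β _ => mul_nonneg (abs_nonneg _) (abs_nonneg _)) (abs_nonneg _)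
  set E : ℝ := 16 * ((d + 1 : ℕ) : ℝ) with hE
  have hE0 : 0 ≤ E := by positivity
  -- the dominating function
  have hdom : Summable fun x : Fin (d + 1) → ℤ =>
      ((M + K) * Real.exp (-δ * l1 (x₀ - x)) + M * (l1 (x₀ - x) ^ 2 * Real.exp (-δ * l1 (x₀ - x)))) * (C * E) := by
    refine Summable.mul_right _ (Summable.add ?_ ?_)
    · exact (ExpKernelCalculus.summable_exp_shift hδ x₀).mul_left _
    · exact ((Equiv.subLeft x₀).summable_iff.mpr (B12Sec2to5.majorant_summable hδ (d + 1))).mul_left _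
  refine Summable.of_norm_bounded hdom fun x => ?_
  rw [Real.norm_eq_abs, abs_mul, abs_mul]
  have hf := abs_affine_weight_le m c x v x₀
  have hAx : |A x₀ x (Sum.inr μ) (Sum.inl α)| ≤ C * Real.exp (-δ * l1 (x₀ - x)) := hA x₀ x _ _
  have hel : |elCol κ' (x - v) α x| ≤ E := abs_elCol_le κ' (x - v) α x
  set r : ℝ := l1 (x₀ - x) with hr
  have hr0 : 0 ≤ r := l1_nonneg _
  have hexp0 : 0 ≤ Real.exp (-δ * r) := (Real.exp_pos _).le
  calc |(∑ β, m β * (((x - v) β : ℤ) : ℝ)) + c| * (|A x₀ x (Sum.inr μ) (Sum.inl α)| * |elCol κ' (x - v) α x|)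
      ≤ (M * r + K) * ((C * Real.exp (-δ * r)) * E) :=
        mul_le_mul hf (mul_le_mul hAx hel (abs_nonneg _) (by positivity)) (by positivity) (by positivity)
    _ = (M * r + K) * Real.exp (-δ * r) * (C * E) := by ring
    _ ≤ ((M + K) * Real.exp (-δ * r) + M * (r ^ 2 * Real.exp (-δ * r))) * (C * E) := by
        refine mul_le_mul_of_nonneg_right ?_ (by positivity)
        have hr1 : r ≤ 1 + r ^ 2 := by nlinarith [sq_nonneg (r - 1 / 2)]
        have h1 : M * r ≤ M * (1 + r ^ 2) := mul_le_mul_of_nonneg_left hr1 hM0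
        nlinarith [hexp0, h1, hK0, hM0]

/-- [folklore] **SUMMABILITY COMPANION** of the affine-moment null: `u ↦ f(u)·lamCoeffOf A N μ y κ′ u` is absolutely summable over `ℤ^{d+1}`. -/
theorem summable_affine_mul_lamCoeffOf {A : MKer (d + 1) (Fib d)} {C δ : ℝ} (hA : Decays A C δ) (hC : 0 ≤ C) (hδ : 0 < δ)
    (m : Fin (d + 1) → ℝ) (c : ℝ) (N : ℕ) (μ : Fin (d + 1)) (y : Fin (d + 1) → ℤ) (κ' : Fin (d + 1)) :
    Summable fun u : Fin (d + 1) → ℤ => ((∑ β, m β * ((u β : ℤ) : ℝ)) + c) * lamCoeffOf A N μ y κ' u := by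
  have hterm : ∀ v ∈ box1 (d + 1), ∀ α ∈ (univ : Finset (Fin (d + 1))), Summable fun u : Fin (d + 1) → ℤ =>
      ((∑ β, m β * ((u β : ℤ) : ℝ)) + c) * (A ((N : ℤ) • y) (u + v) (Sum.inr μ) (Sum.inl α) * elCol κ' u α (u + v)) := by
    intro v _ α _
    have h := (Equiv.addRight v).summable_iff.mpr (summable_shifted_term hA hC hδ m c ((N : ℤ) • y) μ κ' α v)
    refine h.congr fun u => ?_
    simp only [Function.comp_apply, Equiv.coe_addRight, add_sub_cancel_right]
  have h2 : Summable fun u : Fin (d + 1) → ℤ => ∑ v ∈ box1 (d + 1), ∑ α : Fin (d + 1),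
      ((∑ β, m β * ((u β : ℤ) : ℝ)) + c) * (A ((N : ℤ) • y) (u + v) (Sum.inr μ) (Sum.inl α) * elCol κ' u α (u + v)) :=
    summable_sum fun v hv => summable_sum fun α hα => hterm v hv α hα
  refine h2.congr fun u => ?_
  simp only [lamCoeffOf, Finset.mul_sum]

/-- [folklore] **THE AFFINE-MOMENT NULL OF THE MULTIPLIER RESPONSE** (an3 LETTER «Λ-NULL» identity (I)): for every summable left kernel `A`
(`Decays A C δ`, `δ > 0`), blocking `N`, coarse bond `(μ, y)`, fine direction `κ′` and AFFINE weight `f(u) = Σ_β m_β u_β + c`,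
`∑' u, f(u) · lamCoeffOf A N μ y κ′ u = 0` — zero monopole (`m = 0`) and zero dipole (`c = 0`, `m = e_β`) of the `Λ′`-profile `u ↦ Λ′_{(μ,y)}[e_{(κ′,u)}]`.
Proof: Fubini over the finite `(v, α)` sum (§3 summability), lattice shift `u = x − v`, and the finite core `sum_box1_affine_mul_elCol` at each `x`. -/
theorem tsum_affine_mul_lamCoeffOf {A : MKer (d + 1) (Fib d)} {C δ : ℝ} (hA : Decays A C δ) (hC : 0 ≤ C) (hδ : 0 < δ)
    (m : Fin (d + 1) → ℝ) (c : ℝ) (N : ℕ) (μ : Fin (d + 1)) (y : Fin (d + 1) → ℤ) (κ' : Fin (d + 1)) :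
    ∑' u : Fin (d + 1) → ℤ, ((∑ β, m β * ((u β : ℤ) : ℝ)) + c) * lamCoeffOf A N μ y κ' u = 0 := by
  set x₀ : Fin (d + 1) → ℤ := (N : ℤ) • y with hx₀
  -- the summand `(v, α)` by `(v, α)`, before and after the shift `u = x − v`
  set G : (Fin (d + 1) → ℤ) → Fin (d + 1) → (Fin (d + 1) → ℤ) → ℝ := fun v α u =>
    ((∑ β, m β * ((u β : ℤ) : ℝ)) + c) * (A x₀ (u + v) (Sum.inr μ) (Sum.inl α) * elCol κ' u α (u + v)) with hG
  set H : (Fin (d + 1) → ℤ) → Fin (d + 1) → (Fin (d + 1) → ℤ) → ℝ := fun v α x =>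
    ((∑ β, m β * (((x - v) β : ℤ) : ℝ)) + c) * (A x₀ x (Sum.inr μ) (Sum.inl α) * elCol κ' (x - v) α x) with hH
  have hHs : ∀ v α, Summable (H v α) := fun v α => summable_shifted_term hA hC hδ m c x₀ μ κ' α v
  have hGH : ∀ v α, G v α = H v α ∘ (Equiv.addRight v) := by
    intro v α; funext u
    simp only [hG, hH, Function.comp_apply, Equiv.coe_addRight, add_sub_cancel_right]
  have hGs : ∀ v α, Summable (G v α) := fun v α => by
    rw [hGH]; exact (Equiv.addRight v).summable_iff.mpr (hHs v α)
  have hGt : ∀ v α, ∑' u, G v α u = ∑' x, H v α x := fun v α => by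
    rw [hGH]; exact (Equiv.addRight v).tsum_eq (H v α)
  -- pointwise in `x`: the finite core
  have hcore : ∀ x : Fin (d + 1) → ℤ, (∑ v ∈ box1 (d + 1), ∑ α : Fin (d + 1), H v α x) = 0 := by
    intro x
    rw [Finset.sum_comm]
    refine Finset.sum_eq_zero fun α _ => ?_
    have h0 := sum_box1_affine_mul_elCol m c κ' α x
    calc ∑ v ∈ box1 (d + 1), H v α x
        = A x₀ x (Sum.inr μ) (Sum.inl α) * ∑ v ∈ box1 (d + 1), ((∑ β, m β * (((x - v) β : ℤ) : ℝ)) + c) * elCol κ' (x - v) α x := by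
          rw [Finset.mul_sum]
          refine Finset.sum_congr rfl fun v _ => ?_
          simp only [hH]; ring
      _ = 0 := by rw [h0, mul_zero]
  calc ∑' u, ((∑ β, m β * ((u β : ℤ) : ℝ)) + c) * lamCoeffOf A N μ y κ' u
      = ∑' u, ∑ v ∈ box1 (d + 1), ∑ α : Fin (d + 1), G v α u := by
        refine tsum_congr fun u => ?_
        simp only [lamCoeffOf, Finset.mul_sum, hG, hx₀]
    _ = ∑ v ∈ box1 (d + 1), ∑' u, ∑ α : Fin (d + 1), G v α u :=
        Summable.tsum_finsetSum fun v _ => summable_sum fun α _ => hGs v α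
    _ = ∑ v ∈ box1 (d + 1), ∑ α : Fin (d + 1), ∑' u, G v α u := by
        refine Finset.sum_congr rfl fun v _ => ?_
        exact Summable.tsum_finsetSum fun α _ => hGs v α
    _ = ∑ v ∈ box1 (d + 1), ∑ α : Fin (d + 1), ∑' x, H v α x := by
        simp only [hGt]
    _ = ∑ v ∈ box1 (d + 1), ∑' x, ∑ α : Fin (d + 1), H v α x := by
        refine Finset.sum_congr rfl fun v _ => ?_
        exact (Summable.tsum_finsetSum fun α _ => hHs v α).symm
    _ = ∑' x, ∑ v ∈ box1 (d + 1), ∑ α : Fin (d + 1), H v α x :=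
        (Summable.tsum_finsetSum fun v _ => summable_sum fun α _ => hHs v α).symm
    _ = 0 := by simp only [hcore, tsum_zero]

end LamCoeff


end Summit.QuantumFields.BalabanUV.Beta.D1BFx.LamCoeffAffineNull

end
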